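import Mathlib
import Summits.ResolutionOfSingularities.ResolutionOfSingularities.Theorems.RadicialJungCleanModelsL1Presentation
import HarnessLib

/-!
# Lemma L1 of line `via-clean-models` (crux stmt-ResolutionOfSingularities-15917 `RadicialJung.CleanModels`), part 3:
# the (S,h,E)-frame shape `S[X]/(X^p - f)` — if it is a regular local ring then `f - c^p` is clean for some `c ∈ S`

Consumer-ready packaging of the unconditional monogenic cleanness lemma `clean_of_monogenic_regular`
(`RadicialJungCleanModelsL1OfKimuraNiitsuma.lean`, p657241; re-proved here from part 1 with the shift exposed) for the output of Cossart–Piltant's local uniformization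
in the (S,h,E)-frame (J. Algebra 529 (2019), Thm 1.5 (i) with Prop 2.22: the strict transform of `h = X^p + f` under a
local Hironaka-permissible blowing up of the regular base `S` is again `h' = X'^p + f'`, `f' = u^{-p}(f + θ^p) ∈ S'`, and
the sequence ends with `Spec S_r[X]/(h_r)` REGULAR): plan P2(b) of the card
`Cruxes/DescentPerfectToAll/Lines/via-clean-models.md` needs «`S[X]/(X^p - f)` regular ⟹ `f` loosely clean at `S`
after a shift `f ↦ f - c^p`», with the shift `c` EXPLICIT (the representative bookkeeping of
`cleanModels_of_logCleanPrincipalization` tracks `c^p`-translates of the `K^p`-line).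

* `clean_shift_of_monogenic_regular` — `clean_of_monogenic_regular` with the witness exposed: `∃ c ∈ O` with
  `s_γ - c^p` clean (`s_γ - c^p ∈ 𝔪_O ∖ 𝔪_O²`, or a unit with `s_γ - c^p - c'^p ∉ 𝔪_O` for all `c'`).
* `AdjoinRootFrame.*` — for a local ring `S` of characteristic `p` and `f ∈ S`, the `S`-algebra
  `B = AdjoinRoot (X^p - C f) = S[X]/(X^p - f)`: the structure map is injective and local, `B` is a LOCAL ring
  (`b ↦ b^p` lands in `S`, so non-units are closed under addition), finite free with basis `1, x, …, x^{p-1}`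
  (all as theorems, to be introduced with `haveI`; no instances are declared).
* `clean_shift_of_adjoinRoot_regular` — **if `S` is regular local of characteristic `p` and `S[X]/(X^p - f)` is a
  regular local ring, then `f - c^p` is clean for some `c ∈ S`.**  No named fact.

Pure commutative algebra (Mathlib + the two L1 files); lead `res-B-lead-1` g0, 2026-08-28.  Nothing here is a statement
of H. Hironaka's 2017 manuscript, and `CleanModels` in `dim ≥ 3` is not settled by this file.
-/

noncomputable section

set_option linter.dupNamespace false

open IsLocalRing Polynomial

namespace Summit.ResolutionOfSingularities.ResolutionOfSingularities.Theorems.RadicialJung.CleanModels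

universe v w

/-- **Monogenic cleanness with the shift exposed.**  Let `O ⊆ B` be regular local rings of characteristic `p`, `B`
finite over `O` along a local homomorphism, `B = O[γ]` with `γ^p = s_γ ∈ O` and `1, γ, …, γ^{p-1}` linearly independent
over `O`.  Then for some `c ∈ O` the element `s_γ - c^p` (`= (γ - c)^p`) is clean: `s_γ - c^p ∈ 𝔪_O ∖ 𝔪_O²`, or it is
a unit with `s_γ - c^p - c'^p ∉ 𝔪_O` for every `c' ∈ O` (then `c = 0` works). [folklore] -/
theorem clean_shift_of_monogenic_regular {O : Type w} {B : Type v} [CommRing O] [IsRegularLocalRing O] [CommRing B]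
    [IsRegularLocalRing B] [Algebra O B] [Module.Finite O B] [IsLocalHom (algebraMap O B)]
    (p : ℕ) (hp : p.Prime) [CharP B p] (hinj : Function.Injective (algebraMap O B))
    (γ : B) (sγ : O) (hγ : algebraMap O B sγ = γ ^ p) (hadj : Algebra.adjoin O {γ} = ⊤)
    (hli : LinearIndependent O (fun i : Fin p => γ ^ (i : ℕ))) :
    ∃ c : O, (sγ - c ^ p ∈ maximalIdeal O ∧ sγ - c ^ p ∉ maximalIdeal O ^ 2) ∨
      (IsUnit (sγ - c ^ p) ∧ ∀ c' : O, sγ - c ^ p - c' ^ p ∉ maximalIdeal O) := by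
  haveI : Fact p.Prime := ⟨hp⟩
  haveI : CharP O p := (algebraMap O B).charP hinj p
  have hmO : ∀ a : O, a ∈ maximalIdeal O ↔ algebraMap O B a ∈ maximalIdeal B := by
    intro a
    rw [IsLocalRing.mem_maximalIdeal, IsLocalRing.mem_maximalIdeal]
    exact (map_mem_nonunits_iff (algebraMap O B) a).symm
  by_cases hA : ∀ c : O, γ - algebraMap O B c ∉ maximalIdeal B
  · -- residually new generator: `c = 0`
    have hγu : IsUnit γ := by
      by_contra h
      exact hA 0 (by rw [map_zero, sub_zero]; exact h)
    have hsu : IsUnit sγ := by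
      rw [← isUnit_map_iff (algebraMap O B) sγ, hγ]
      exact hγu.pow p
    refine ⟨0, Or.inr ?_⟩
    rw [zero_pow hp.ne_zero, sub_zero]
    refine ⟨hsu, fun c hc => hA c ?_⟩
    have hpow : (γ - algebraMap O B c) ^ p ∈ maximalIdeal B := by
      rw [sub_pow_char, ← hγ, ← map_pow, ← map_sub]
      exact (hmO _).mp hc
    exact (IsLocalRing.maximalIdeal.isMaximal B).isPrime.mem_of_pow_mem p hpow
  · -- `γ̄ = c̄`: shift into `𝔪_B` and count cotangent vectors
    push Not at hA
    obtain ⟨c, hc⟩ := hA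
    set y : B := γ - algebraMap O B c with hydef
    set s : O := sγ - c ^ p with hsdef
    have hys : algebraMap O B s = y ^ p := by
      rw [hsdef, hydef, map_sub, map_pow, hγ, sub_pow_char]
    obtain ⟨hsurjγ, hkerγ⟩ :=
      aeval_surjective_and_ker_eq_of_linearIndependent_pow hp.pos γ sγ hγ hadj hli
    obtain ⟨hsurj, hker⟩ := presentation_shift γ sγ hsurjγ hkerγ c
    have hsm : s ∈ maximalIdeal O := by
      rw [hmO, hys]
      exact Ideal.pow_mem_of_mem _ hc p hp.pos
    have hs2 : s ∉ maximalIdeal O ^ 2 := not_mem_sq_of_presentation hinj hp y s hc hsurj hker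
    exact ⟨c, Or.inl ⟨hsm, hs2⟩⟩

/-! ## The frame algebra `S[X]/(X^p - f)` over a local ring of characteristic `p` -/

namespace AdjoinRootFrame

/-- The frame polynomial `X^p - f` is monic. [folklore] -/
theorem monic {S : Type v} [CommRing S] (p : ℕ) [hp : Fact p.Prime] (f : S) : (X ^ p - C f : S[X]).Monic := monic_X_pow_sub_C f hp.out.ne_zero

/-- The power basis `1, x, …, x^{p-1}` of `S[X]/(X^p - f)` (`AdjoinRoot.powerBasis'`) has `p` elements. [folklore] -/
theorem dim_eq {S : Type v} [CommRing S] [Nontrivial S] (p : ℕ) [hp : Fact p.Prime] (f : S) : (AdjoinRoot.powerBasis' (monic p f)).dim = p := by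
  rw [AdjoinRoot.powerBasis'_dim, natDegree_X_pow_sub_C]

/-- `S[X]/(X^p - f)` is a finite `S`-module. [folklore] -/
theorem finite {S : Type v} [CommRing S] (p : ℕ) [hp : Fact p.Prime] (f : S) : Module.Finite S (AdjoinRoot (X ^ p - C f : S[X])) := (monic p f).finite_adjoinRoot

/-- The root satisfies `x^p = f`. [folklore] -/
theorem root_pow {S : Type v} [CommRing S] (p : ℕ) (f : S) :
    algebraMap S (AdjoinRoot (X ^ p - C f : S[X])) f = AdjoinRoot.root (X ^ p - C f : S[X]) ^ p := by
  have h := AdjoinRoot.aeval_eq (f := (X ^ p - C f : S[X])) (X ^ p - C f)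
  rw [AdjoinRoot.mk_self, map_sub, map_pow, aeval_X, aeval_C] at h
  exact (sub_eq_zero.mp h).symm

/-- The coordinate of index `0` of `algebraMap S B s` in the power basis is `s`. [folklore] -/
theorem repr_algebraMap_zero {S : Type v} [CommRing S] [Nontrivial S] (p : ℕ) [hp : Fact p.Prime] (f : S) (s : S) :
    (AdjoinRoot.powerBasis' (monic p f)).basis.repr (algebraMap S (AdjoinRoot (X ^ p - C f : S[X])) s) ⟨0, by rw [dim_eq]; exact hp.out.pos⟩
      = s := by
  have h1 : algebraMap S (AdjoinRoot (X ^ p - C f : S[X])) s = s • (AdjoinRoot.powerBasis' (monic p f)).basis ⟨0, by rw [dim_eq]; exact hp.out.pos⟩ := by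
    rw [PowerBasis.coe_basis, Algebra.algebraMap_eq_smul_one]
    simp
  rw [h1, map_smul, Module.Basis.repr_self]
  simp

/-- The structure map `S → S[X]/(X^p - f)` is injective. [folklore] -/
theorem algebraMap_injective {S : Type v} [CommRing S] [Nontrivial S] (p : ℕ) [hp : Fact p.Prime] (f : S) : Function.Injective (algebraMap S (AdjoinRoot (X ^ p - C f : S[X]))) := by
  intro a b hab
  have := congrArg (fun z => (AdjoinRoot.powerBasis' (monic p f)).basis.repr z ⟨0, by rw [dim_eq]; exact hp.out.pos⟩) hab
  simpa only [repr_algebraMap_zero] using this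

/-- Units of `S` are exactly the elements mapping to units of `S[X]/(X^p - f)` (read the coordinate of index `0` of an
inverse). [folklore] -/
theorem isLocalHom {S : Type v} [CommRing S] [Nontrivial S] (p : ℕ) [hp : Fact p.Prime] (f : S) : IsLocalHom (algebraMap S (AdjoinRoot (X ^ p - C f : S[X]))) := by
  constructor
  intro s hs
  obtain ⟨u, hu⟩ := hs
  set b : AdjoinRoot (X ^ p - C f : S[X]) := ↑u⁻¹ with hb
  have h1 : algebraMap S _ s * b = 1 := by rw [← hu, hb, Units.mul_inv]
  have h2 : (AdjoinRoot.powerBasis' (monic p f)).basis.repr (algebraMap S _ s * b) ⟨0, by rw [dim_eq]; exact hp.out.pos⟩ =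
      s * (AdjoinRoot.powerBasis' (monic p f)).basis.repr b ⟨0, by rw [dim_eq]; exact hp.out.pos⟩ := by
    rw [← Algebra.smul_def, map_smul, Finsupp.smul_apply, smul_eq_mul]
  rw [h1, ← (algebraMap S (AdjoinRoot (X ^ p - C f : S[X]))).map_one, repr_algebraMap_zero] at h2
  exact IsUnit.of_mul_eq_one _ h2.symm

/-- In characteristic `p`, every element of `S[X]/(X^p - f)` has its `p`-th power in `S`. [folklore] -/
theorem exists_pow_eq {S : Type v} [CommRing S] [Nontrivial S] (p : ℕ) [hp : Fact p.Prime] (f : S) [CharP S p] (b : AdjoinRoot (X ^ p - C f : S[X])) :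
    ∃ s : S, algebraMap S (AdjoinRoot (X ^ p - C f : S[X])) s = b ^ p := by
  haveI : CharP (AdjoinRoot (X ^ p - C f : S[X])) p :=
    charP_of_injective_algebraMap (algebraMap_injective p f) p
  have hmem : b ∈ Algebra.adjoin S ({AdjoinRoot.root (X ^ p - C f : S[X])} : Set _) := by
    rw [AdjoinRoot.adjoinRoot_eq_top]; trivial
  refine Algebra.adjoin_induction (p := fun b _ => ∃ s : S, algebraMap S _ s = b ^ p) ?_ ?_ ?_ ?_ hmem
  · rintro x hx
    rw [Set.mem_singleton_iff] at hx
    subst hx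
    exact ⟨f, root_pow p f⟩
  · intro r
    exact ⟨r ^ p, by rw [map_pow]⟩
  · rintro x y - - ⟨s, hs⟩ ⟨t, ht⟩
    exact ⟨s + t, by rw [map_add, hs, ht, add_pow_char]⟩
  · rintro x y - - ⟨s, hs⟩ ⟨t, ht⟩
    exact ⟨s * t, by rw [map_mul, hs, ht, mul_pow]⟩

/-- Over a LOCAL ring `S` of characteristic `p`, `S[X]/(X^p - f)` is a local ring: `b` is a unit iff `b^p ∈ S` is, and
`p`-th powers are additive, so the non-units are closed under addition (the cover is radicial). [folklore] -/
theorem isLocalRing {S : Type v} [CommRing S] [IsLocalRing S] (p : ℕ) [hp : Fact p.Prime] (f : S) [CharP S p] :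
    IsLocalRing (AdjoinRoot (X ^ p - C f : S[X])) := by
  haveI : Nontrivial (AdjoinRoot (X ^ p - C f : S[X])) := (algebraMap_injective p f).nontrivial
  haveI : CharP (AdjoinRoot (X ^ p - C f : S[X])) p :=
    charP_of_injective_algebraMap (algebraMap_injective p f) p
  haveI := isLocalHom p f
  have hunit : ∀ (b : AdjoinRoot (X ^ p - C f : S[X])) (s : S), algebraMap S _ s = b ^ p →
      (IsUnit b ↔ IsUnit s) := by
    intro b s hs
    rw [← isUnit_pow_iff hp.out.ne_zero, ← hs]
    exact isUnit_map_iff (algebraMap S _) s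
  refine IsLocalRing.of_nonunits_add fun a b ha hb => ?_
  obtain ⟨s, hs⟩ := exists_pow_eq p f a
  obtain ⟨t, ht⟩ := exists_pow_eq p f b
  have hst : algebraMap S _ (s + t) = (a + b) ^ p := by rw [map_add, hs, ht, add_pow_char]
  rw [mem_nonunits_iff, hunit _ _ hst]
  rw [mem_nonunits_iff, hunit _ _ hs] at ha
  rw [mem_nonunits_iff, hunit _ _ ht] at hb
  exact IsLocalRing.nonunits_add ha hb

/-- `1, x, …, x^{p-1}` are linearly independent over `S`. [folklore] -/
theorem linearIndependent_pow {S : Type v} [CommRing S] [Nontrivial S] (p : ℕ) [hp : Fact p.Prime] (f : S) :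
    LinearIndependent S (fun i : Fin p => AdjoinRoot.root (X ^ p - C f : S[X]) ^ (i : ℕ)) := by
  have h := (AdjoinRoot.powerBasis' (monic p f)).basis.linearIndependent
  rw [PowerBasis.coe_basis, AdjoinRoot.powerBasis'_gen] at h
  -- reindex along `Fin p → Fin (AdjoinRoot.powerBasis' (monic p f)).dim`
  exact (h.comp (Fin.cast (dim_eq p f).symm) (Fin.cast_injective _))

end AdjoinRootFrame

/-- **The frame lemma.**  Let `S` be a regular local ring of characteristic `p` and `f ∈ S`.  If the radicial cover
`S[X]/(X^p - f)` is a regular local ring, then for some `c ∈ S` the translate `f - c^p` is CLEAN at `S`: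
`f - c^p ∈ 𝔪_S ∖ 𝔪_S²` (parameter type), or `f - c^p` is a unit with `f - c^p - c'^p ∉ 𝔪_S` for every `c' ∈ S`
(residually new unit).  This is the local conversion step of plan P2(b) (Cossart–Piltant's (S,h,E)-frame ends with
`Spec S_r[X]/(X^p + f_r)` regular; apply with `f := -f_r`).  Unconditional. [folklore] -/
theorem clean_shift_of_adjoinRoot_regular {S : Type v} [CommRing S] [IsRegularLocalRing S] (p : ℕ) (hp : p.Prime)
    [CharP S p] (f : S) (hreg : IsRegularLocalRing (AdjoinRoot (X ^ p - C f : S[X]))) :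
    ∃ c : S, (f - c ^ p ∈ maximalIdeal S ∧ f - c ^ p ∉ maximalIdeal S ^ 2) ∨
      (IsUnit (f - c ^ p) ∧ ∀ c' : S, f - c ^ p - c' ^ p ∉ maximalIdeal S) := by
  haveI : Fact p.Prime := ⟨hp⟩
  haveI := hreg
  haveI : CharP (AdjoinRoot (X ^ p - C f : S[X])) p :=
    charP_of_injective_algebraMap (AdjoinRootFrame.algebraMap_injective p f) p
  haveI := AdjoinRootFrame.finite p f
  haveI := AdjoinRootFrame.isLocalHom p f
  exact clean_shift_of_monogenic_regular p hp (AdjoinRootFrame.algebraMap_injective p f)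
    (AdjoinRoot.root (X ^ p - C f : S[X])) f (AdjoinRootFrame.root_pow p f) (AdjoinRoot.adjoinRoot_eq_top)
    (AdjoinRootFrame.linearIndependent_pow p f)

end Summit.ResolutionOfSingularities.ResolutionOfSingularities.Theorems.RadicialJung.CleanModels

end
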